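import Literature.MathematicalPhysics.QuantumLattice.MagneticHubbardTorusGauge
import Literature.MathematicalPhysics.QuantumLattice.FockRelabel
import Literature.MathematicalPhysics.QuantumLattice.HubbardBondAlgebra
import Literature.MathematicalPhysics.QuantumLattice.InfVolFermionState
import HarnessLib

/-!
# Relabelling and embedding a site-phase unitary: `Γ_e (W_g) = W_{g ∘ e⁻¹}`, `T_v W_g T_v⁻¹ = W_{g(· − v)}`,
# `jwEmbed (W_g) = W_{g'}` for any extension `g'` of `g` by `1`

Topic `Literature/MathematicalPhysics/QuantumLattice` (namespace = path; family `hubbard`). A small brick for the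
interplay of the two symmetry implementers of the fermion Fock space used throughout the Hubbard files: the
second-quantised orbital bijection `relabel` (`FermionRelabelling.lean`, `FockRelabel.lean`: translations
`Orb.translate v`, site permutations `Orb.mapEquiv`) and the site-phase (local gauge) unitary `phaseGauge g`
(`MagneticHubbardTorus(Gauge).lean`). Since `phaseGauge g` is diagonal in the occupation basis with entry
`∏_{(x,σ) ∈ s} g x` and `relabel e` conjugates by a SIGNED permutation of that basis (the signs square to one),
relabelling a diagonal matrix just moves its entries:

(using the tree's `relabel_diagonal` of `HyperoctahedralFockAction.lean`)
* **`relabel_mapEquiv_phaseGauge`**: `relabel (Orb.mapEquiv f) (phaseGauge g) = phaseGauge (g ∘ f.symm)`;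
* **`relabel_translate_phaseGauge`**: on the torus, `relabel (Orb.translate v) (phaseGauge G) =
  phaseGauge (u ↦ G(u − v))` — the translate of a local gauge transformation is the gauge transformation by the
  translated phase function (first brick of the periodisation of gauge-rotated local observables, Hubbard cuprate
  cell `hubbard-cq`, row T8);
* `JWEmbed.embedFun_diagonal`, **`jwEmbed_orbEmb_phaseGauge`**: the Jordan–Wigner embedding along a site order
  embedding `φ` sends `W_g` to `W_{g'}` for every `g'` with `g' ∘ φ = g` and `g' = 1` off the range of `φ`
  (second brick), and **`fermionEmbed_phaseGauge`** — the same for the isotony map `fermionEmbed φ = jwEmbed ∘ relabel`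
  of `InfVolFermionState.lean` (so `Γ(W_loc X W_locᴴ) = W_{g'} Γ(X) W_{g'}ᴴ` by multiplicativity).

All PROVED, no definition.

## References
* O. Bratteli, D. W. Robinson, *Operator Algebras and Quantum Statistical Mechanics II* (1997), §5.2.2,
  Thm. 5.2.5 (unitarily implemented Bogoliubov transformations). [cite: BratteliRobinsonII1997, §5.2.2, Thm. 5.2.5]
* T. Koma, H. Tasaki, PRL 68 (1992) 3248, eq. (5) (site-phase unitaries). [cite: KomaTasakiPRL1992, eq. (5)]
-/

noncomputable section

namespace Literature.MathematicalPhysics.QuantumLattice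

open _root_.Matrix Finset Literature.Probability.LatticeModels HubbardWave0


section Sites

variable {Λ Λ' : Type*} [LinearOrder Λ] [LinearOrder Λ'] [Fintype Λ] [Fintype Λ']

/-- **Relabelling a site-phase unitary along a site bijection**: `relabel (Orb.mapEquiv f) (W_g) = W_{g ∘ f⁻¹}` — the
phase that sat at `x` now sits at `f x`. [cite: KomaTasakiPRL1992, eq. (5)] -/
theorem relabel_mapEquiv_phaseGauge (f : Λ ≃ Λ') (g : Λ → Circle) :
    relabel (Orb.mapEquiv f) (phaseGauge g) = phaseGauge (g ∘ f.symm) := by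
  rw [phaseGauge_eq, phaseGauge_eq, relabel_diagonal]
  congr 1
  funext s'
  rw [Equiv.finsetCongr_symm, Equiv.finsetCongr_apply, Finset.prod_map]
  rfl

end Sites

section Torus

variable {d L : ℕ} [NeZero L]

/-- **Translating a site-phase unitary on the torus**: `relabel (Orb.translate v) (W_G) = W_{G(· − v)}`.
[cite: KomaTasakiPRL1992, eq. (5)] -/
theorem relabel_translate_phaseGauge (v : TorusSite d L) (G : FermionTorus d L → Circle) :
    relabel (Orb.translate v) (phaseGauge G) =
      phaseGauge fun u : FermionTorus d L => G (FermionTorus.ofTorusSite (u.toTorusSite - v)) := by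
  rw [Orb.translate, relabel_mapEquiv_phaseGauge]
  congr 1
  funext u
  show G ((FermionTorus.ofTorusEquiv (Equiv.addRight v)).symm u) = _
  congr 1
  apply (FermionTorus.ofTorusEquiv (Equiv.addRight v)).injective
  rw [Equiv.apply_symm_apply, FermionTorus.ofTorusEquiv_ofTorusSite, Equiv.coe_addRight]
  show u = FermionTorus.ofTorusSite (u.toTorusSite - v + v)
  rw [sub_add_cancel, FermionTorus.ofTorusSite_toTorusSite]

/-- The same for a phase function of the torus coordinates: `relabel (Orb.translate v) (W_{g ∘ coords}) =
W_{(x ↦ g(x − v)) ∘ coords}`. [cite: KomaTasakiPRL1992, eq. (5)] -/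
theorem relabel_translate_phaseGauge_toTorusSite (v : TorusSite d L) (g : TorusSite d L → Circle) :
    relabel (Orb.translate v) (phaseGauge fun u : FermionTorus d L => g u.toTorusSite) =
      phaseGauge fun u : FermionTorus d L => g (u.toTorusSite - v) := by
  rw [relabel_translate_phaseGauge]
  congr 1
  funext u
  simp only [FermionTorus.toTorusSite_ofTorusSite]

end Torus

section Embed

open JWEmbed
open scoped symmDiff

variable {ι ι' : Type*} [LinearOrder ι] [LinearOrder ι'] [Fintype ι] [Fintype ι'] (e : ι ↪o ι')

omit [Fintype ι'] in
/-- **The Jordan–Wigner embedding of a diagonal matrix is diagonal**: `embedFun e (diagonal f) u' = f (pre e u')`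
(no sign: the symmetric difference of `pre u'` with itself is empty). [cite: BratteliRobinsonII1997, §5.2.2, Thm. 5.2.5] -/
theorem JWEmbed.embedFun_diagonal (f : Finset ι → ℂ) :
    embedFun e (diagonal f) = diagonal fun u' => f (pre e u') := by
  ext u' v'
  rw [embedFun_apply]
  by_cases h : u' = v'
  · subst h
    rw [if_pos rfl, symmDiff_self, Finset.bot_eq_empty, transSign_empty, mul_one, diagonal_apply_eq,
      diagonal_apply_eq]
  · rw [diagonal_apply_ne _ h]
    by_cases henv : env e u' = env e v'
    · have hpre : pre e u' ≠ pre e v' := fun h' => h (eq_iff_pre_eq_and_env_eq.2 ⟨h', henv⟩)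
      rw [if_pos henv, diagonal_apply_ne _ hpre, zero_mul]
    · rw [if_neg henv]

end Embed

section EmbedSites

open JWEmbed

variable {Λ Λ' : Type*} [LinearOrder Λ] [LinearOrder Λ'] [Fintype Λ] [Fintype Λ']

/-- **Embedding a site-phase unitary**: along a site order embedding `φ`, `jwEmbed (orbEmb φ) (W_g) = W_{g'}` for every
phase function `g'` of the big region that extends `g` (`g' (φ x) = g x`) and is trivial off the range of `φ`.
[cite: KomaTasakiPRL1992, eq. (5)] -/
theorem jwEmbed_orbEmb_phaseGauge (φ : Λ ↪o Λ') (g : Λ → Circle) (g' : Λ' → Circle)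
    (hg : ∀ x, g' (φ x) = g x) (h1 : ∀ y, (∀ x, φ x ≠ y) → g' y = 1) :
    jwEmbed (orbEmb φ) (phaseGauge g) = phaseGauge g' := by
  rw [jwEmbed_apply, phaseGauge_eq, phaseGauge_eq, JWEmbed.embedFun_diagonal]
  congr 1
  funext u'
  congr 1
  -- split `u'` into the image of `pre u'` and the environment
  conv_rhs => rw [← combine_pre_env (e := orbEmb φ) u']
  have hdisj : Disjoint ((pre (orbEmb φ) u').map (orbEmb φ).toEmbedding) (env (orbEmb φ) u') := by
    refine Finset.disjoint_left.2 fun o ho henv => ?_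
    obtain ⟨i, -, rfl⟩ := Finset.mem_map.1 ho
    exact (mem_env.1 henv).2 (apply_mem_rangeF i)
  rw [combine, Finset.prod_union hdisj, Finset.prod_map]
  have henv1 : ∏ o ∈ env (orbEmb φ) u', g' (ofLex o).1 = 1 := by
    refine Finset.prod_eq_one fun o ho => h1 _ fun x hx => (mem_env.1 ho).2 ?_
    refine mem_rangeF.2 ⟨orb x (ofLex o).2, ?_⟩
    rw [orbEmb_orb, hx]
    rfl
  rw [henv1, mul_one]
  refine Finset.prod_congr rfl fun o _ => ?_
  show g (ofLex o).1 = g' (ofLex (orbEmb φ o)).1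
  exact (hg _).symm

end EmbedSites

section FermionEmbed

variable {Λ Λ' : Type*} [LinearOrder Λ] [Fintype Λ] [LinearOrder Λ'] [Fintype Λ']

/-- **The isotony map of the local CAR algebras sends a site-phase unitary to a site-phase unitary**:
`fermionEmbed φ (W_g) = W_{g'}` for every phase function `g'` of the big region with `g' (φ x) = g x` that is trivial
off the range of `φ` (`Γ(φ) = jwEmbed ∘ relabel`, the two previous bricks). [cite: KomaTasakiPRL1992, eq. (5)] -/
theorem fermionEmbed_phaseGauge (φ : Λ ↪ Λ') (g : Λ → Circle) (g' : Λ' → Circle)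
    (hg : ∀ x, g' (φ x) = g x) (h1 : ∀ y, (∀ x, φ x ≠ y) → g' y = 1) :
    fermionEmbed φ (phaseGauge g) = phaseGauge g' := by
  rw [fermionEmbed_apply, relabel_mapEquiv_phaseGauge]
  refine jwEmbed_orbEmb_phaseGauge (rangeOrderEmb φ) _ g' (fun r => ?_) (fun y hy => h1 y fun x hx => ?_)
  · obtain ⟨x, rfl⟩ := (rangeEquiv φ).surjective r
    rw [rangeOrderEmb_rangeEquiv, Function.comp_apply, Equiv.symm_apply_apply, hg]
  · exact hy (rangeEquiv φ x) (by rw [rangeOrderEmb_rangeEquiv, hx])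

end FermionEmbed

end Literature.MathematicalPhysics.QuantumLattice
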